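import Mathlib
import Summits.KontsevichZagierPeriods.Zeta5Search.BigPrimeNineResidual
import HarnessLib.Audit
import HarnessLib

/-!
# `F̃₉(b)`: the big-prime windows are SHARP BELOW `b₀` too — `v_p(K_u) = 0` at the first prime(-multiple) past `d₉ + 2`
# in the whole slot regime `p ≥ b₀ + 1 − b₍₂₎ − b₍₃₎`

Cell `pub-zeta5` (HONEST FRAMING: systematic search; no irrationality claim unless certified).  Provenance: written
by the family-designer seat `pub-zeta5-fam-vwp-g13` (planner role, no stage permission; staged for the cell's lane).
OUR theorems (Summit side; coefficient arithmetic only, no irrationality content).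

`BigPrimeNineSharp` proved that the windows `(W)₉∞ / (U)₉∞ / (S)₉∞` of `BigPrimeNineDivisibility` END at `d₉ + 2`
for primes ABOVE `b₀`: at `p = d₉+3` (`2p = d₉+3`, `3p = d₉+3`) the coefficient `K₃` (`K₅`, `K₇`) of
`F̃₉(b) = 2K₃ζ(3) + 2K₅ζ(5) + 2K₇ζ(7) − K₀` is non-zero with `v_p = 0`.  Below `b₀` this was OBSERVED-EXACT
(`g13/sharp_scan.py`: `18,558` instances with `b₀ ≤ 19` in the slot regime, `0` exceptions).  This file PROVES it in the
whole two-level slot regime `b₀ + 1 ≤ p + b_{j₂} + b_{j₃}` of `BigPrimeNineWindow` (which contains the range above `b₀`):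

* `natDegree_M2_eq`, `leadingCoeff_M2`: the level-2 dual polynomial `M2` of `BigPrimeNineDual2` has degree EXACTLY
  `10p + 2Σβ_j − 8n − 7` and leading coefficient `2` (`p ≥ 3`; every Wilson complement is a product of distinct monic
  linear factors because blocks and rims inject into `𝔽_p` in the slot regime).
* `sum_taylor_coeff_card_top`: the CRITICAL top power sum — for `(X^p − X)² ∣ M` of degree `p² + p − 1`,
  `Σ_{x∈𝔽_p} [X^p] M(X + x) = lc(M)` (read on `N = M/(X^p−X)²` at index `p − 2` with `BigPrime.sum_taylor_coeff_top`);
  it settles the residual top instances `p = 7 = d₉ + 3` (for `K₃`) and `p = 5`, `2p = d₉ + 3` (for `K₅`), exactly as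
  `BigPrimeNineResidual` settled the residual window instances.
* **`padicValRat_coeff3_eq_zero_of_slots`** (`p ≥ 7`, `p = d₉+3`), **`padicValRat_coeff5_eq_zero_of_slots`** (`p ≥ 5`,
  `2p = d₉+3`), **`padicValRat_coeff7_eq_zero_of_slots`** (`p ≥ 5`, `3p = d₉+3`): with slots `j₁` (dropped), `j₂ ≠ j₁`,
  `j₃` (`b_{j₂} ≤ b_{j₃} ≤ b_j` for `j ∉ {j₁, j₂}`) and `b₀ + 1 ≤ p + b_{j₂} + b_{j₃}`: `K_u ≠ 0 ∧ v_p(K_u) = 0`.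
  So in the slot regime the windows of Theorem `thm:bp9` are EXACTLY `[max(7/5/5, L₂), d₉+2]` (`∩ uℤ⁻¹(…)`), on both
  sides of `b₀`; the thresholds `7/5/5` are those of the scan (every scanned instance is now a theorem instance).
-/

noncomputable section

open Finset Polynomial

namespace Summit.KontsevichZagierPeriods.Zeta5Search.BigPrimeNine

open Summit.KontsevichZagierPeriods.Zeta5Search.DualSeriesNine (InBox coeff3 coeff5 coeff7 coeff3_eq coeff5_eq coeff7_eq
  exists_isPFData9 IsPFData9)
open Summit.KontsevichZagierPeriods.Zeta5Search.DualSeriesNineMinors (dNine)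
open Summit.KontsevichZagierPeriods.Zeta5Search.BigPrime (block blockF KF KC rimL rimR block_subset block_mono
  cast_injOn_block cast_injOn_Ico cast_injOn_Ioc sum_taylor_coeff_top padicValRat_eq_zero_of_eq)

/-! ### 1. Exact degree and leading coefficient of `M2`; the critical top power sum -/

section ModP2

variable {p : ℕ} [hp : Fact p.Prime]

/-- `2 ≠ 0` in `𝔽_p` for `p ≥ 3`. -/
theorem two_ne_zero_zmod (hp3 : 3 ≤ p) : (2 : ZMod p) ≠ 0 := by
  change ((2 : ℕ) : ZMod p) ≠ 0
  rw [Ne, ZMod.natCast_eq_zero_iff]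
  intro h; have := Nat.le_of_dvd (by norm_num) h; omega

/-- `deg M2 + 8n + 7 = 10p + 2Σ_j β_j` EXACTLY in the slot regime (`p ≥ 3`): the bound `natDegree_M2_le` of
`BigPrimeNineDual2` is attained, every factor being a product of distinct monic linear factors. -/
theorem natDegree_M2_eq (hp3 : 3 ≤ p) {n : ℕ} {β : ℕ → ℕ} {j₁ j₂ j₃ : ℕ} (hj₁ : j₁ ∈ range 9)
    (hj₂ : j₂ ∈ (range 9).erase j₁) (hS : n + 1 ≤ p + 2 * β j₃) (hT : n + 1 ≤ p + β j₂ + β j₃) (h23 : β j₂ ≤ β j₃)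
    (hmin : ∀ j ∈ ((range 9).erase j₁).erase j₂, β j₃ ≤ β j) (hβ : ∀ j ∈ range 9, 2 * β j ≤ n)
    (hj₃ : 2 * β j₃ ≤ n) :
    (M2 p n β j₁ j₂ j₃).natDegree + 8 * n + 7 = 10 * p + 2 * ∑ j ∈ range 9, β j := by
  have h2z := two_ne_zero_zmod hp3
  have hlin : (C (2 : ZMod p) * X + C (n : ZMod p)).natDegree = 1 := natDegree_linear h2z
  have hlin0 : (C (2 : ZMod p) * X + C (n : ZMod p)) ≠ 0 :=
    ne_zero_of_natDegree_gt (n := 0) (by rw [hlin]; norm_num)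
  have hmidm : (∏ s ∈ range (n + 1) \ block n (β j₁), (X + C (s : ZMod p))).Monic :=
    monic_prod_of_monic _ _ fun s _ => monic_X_add_C _
  have hKFm : ∀ βj : ℕ, (KF p n βj).Monic := fun βj => monic_prod_of_monic _ _ fun u _ => monic_X_add_C _
  have hKCm : ∀ T : Finset ℕ, (KC p T).Monic := fun T => monic_prod_of_monic _ _ fun u _ => monic_X_add_C _
  have hprodm : (∏ j ∈ ((range 9).erase j₁).erase j₂, KF p n (β j)).Monic :=
    monic_prod_of_monic _ _ fun j _ => hKFm _
  -- the polynomial middle factor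
  have hmid : (∏ s ∈ range (n + 1) \ block n (β j₁), (X + C (s : ZMod p))).natDegree = 2 * β j₁ := by
    rw [natDegree_prod_of_monic _ _ fun s _ => monic_X_add_C _]
    have hcard : #(range (n + 1) \ block n (β j₁)) = 2 * β j₁ := by
      have h1 := card_sdiff_add_card_eq_card (block_subset n (β j₁))
      rw [block, Nat.card_Icc, card_range] at h1
      have := hβ j₁ hj₁
      rw [block]
      omega
    simp only [natDegree_X_add_C, sum_const, smul_eq_mul, mul_one, hcard]
  -- every KF with block inside S'
  have hKbd : ∀ βj : ℕ, 2 * βj ≤ n → β j₃ ≤ βj → (KF p n βj).natDegree + (n + 1) = p + 2 * βj := by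
    intro βj hb h3j
    have hsub : block n βj ⊆ block n (β j₃) := block_mono h3j
    have hcard : #(blockF p n βj) = (n - βj) + 1 - βj := by
      rw [blockF, card_image_of_injOn ((cast_injOn_block hS).mono (by exact_mod_cast hsub)), block, Nat.card_Icc]
    have hdeg : (KF p n βj).natDegree = p - #(blockF p n βj) := by
      rw [KF, natDegree_prod_of_monic _ _ fun u _ => monic_X_add_C _]
      simp only [natDegree_X_add_C, sum_const, card_univ_sdiff, ZMod.card, smul_eq_mul, mul_one]
    have hle : #(blockF p n βj) ≤ p := (card_le_univ _).trans (ZMod.card p).le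
    rw [hcard] at hle
    rw [hdeg, hcard]
    omega
  have hK : ∀ j ∈ ((range 9).erase j₁).erase j₂, (KF p n (β j)).natDegree + (n + 1) = p + 2 * β j := by
    intro j hj
    have hj9 : j ∈ range 9 := (mem_erase.1 (mem_erase.1 hj).2).2
    exact hKbd (β j) (hβ j hj9) (hmin j hj)
  have hK3 : (KF p n (β j₃)).natDegree + (n + 1) = p + 2 * β j₃ := hKbd (β j₃) hj₃ le_rfl
  -- rim complements
  have hKC : ∀ T : Finset ℕ, Set.InjOn (Nat.cast : ℕ → ZMod p) (T : Set ℕ) → (KC p T).natDegree + #T = p := by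
    intro T hinj
    have hdeg : (KC p T).natDegree = p - #(T.image (Nat.cast : ℕ → ZMod p)) := by
      rw [KC, natDegree_prod_of_monic _ _ fun u _ => monic_X_add_C _]
      simp only [natDegree_X_add_C, sum_const, card_univ_sdiff, ZMod.card, smul_eq_mul, mul_one]
    rw [card_image_of_injOn hinj] at hdeg
    have : #T ≤ p := by
      rw [← card_image_of_injOn hinj]
      exact (card_le_univ _).trans (ZMod.card p).le
    omega
  have hKL := hKC _ (cast_injOn_Ico (a := β j₂) (c := β j₃) (by omega))
  have hKR := hKC _ (cast_injOn_Ioc (a := n - β j₃) (c := n - β j₂) (by omega))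
  simp only [Nat.card_Ico] at hKL
  simp only [Nat.card_Ioc] at hKR
  have hKL' : (KC p (rimL (β j₂) (β j₃))).natDegree + (β j₃ - β j₂) = p := hKL
  have hKR' : (KC p (rimR n (β j₂) (β j₃))).natDegree + (n - β j₂ - (n - β j₃)) = p := hKR
  have hKsum : (∑ j ∈ ((range 9).erase j₁).erase j₂, (KF p n (β j)).natDegree) + 7 * (n + 1) =
      7 * p + 2 * ∑ j ∈ ((range 9).erase j₁).erase j₂, β j := by
    have := sum_congr rfl hK
    rw [sum_add_distrib, sum_const, sum_add_distrib, sum_const, card_erase_of_mem hj₂, card_erase_of_mem hj₁,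
      card_range, smul_eq_mul, smul_eq_mul, ← mul_sum] at this
    omega
  have hM2 : (M2 p n β j₁ j₂ j₃).natDegree = 1 + 2 * β j₁ +
      ((∑ j ∈ ((range 9).erase j₁).erase j₂, (KF p n (β j)).natDegree) + (KF p n (β j₃)).natDegree +
        ((KC p (rimL (β j₂) (β j₃))).natDegree + (KC p (rimR n (β j₂) (β j₃))).natDegree)) := by
    rw [M2, natDegree_mul (mul_ne_zero hlin0 hmidm.ne_zero)
      ((hprodm.mul (hKFm _)).mul ((hKCm _).mul (hKCm _))).ne_zero, natDegree_mul hlin0 hmidm.ne_zero, hlin, hmid,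
      (hprodm.mul (hKFm _)).natDegree_mul ((hKCm _).mul (hKCm _)), hprodm.natDegree_mul (hKFm _),
      (hKCm _).natDegree_mul (hKCm _), natDegree_prod_of_monic _ _ fun j _ => hKFm (β j)]
  have h3 : ∑ j ∈ ((range 9).erase j₁).erase j₂, β j + β j₂ + β j₁ = ∑ j ∈ range 9, β j := by
    rw [sum_erase_add _ _ hj₂, sum_erase_add _ _ hj₁]
  omega

/-- The leading coefficient of the level-2 dual polynomial `M2` is `2` (`p ≥ 3`). -/
theorem leadingCoeff_M2 (hp3 : 3 ≤ p) (n : ℕ) (β : ℕ → ℕ) (j₁ j₂ j₃ : ℕ) :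
    (M2 p n β j₁ j₂ j₃).leadingCoeff = 2 := by
  have h2z := two_ne_zero_zmod hp3
  have hmidm : (∏ s ∈ range (n + 1) \ block n (β j₁), (X + C (s : ZMod p))).Monic :=
    monic_prod_of_monic _ _ fun s _ => monic_X_add_C _
  have hKFm : ∀ βj : ℕ, (KF p n βj).Monic := fun βj => monic_prod_of_monic _ _ fun u _ => monic_X_add_C _
  have hKCm : ∀ T : Finset ℕ, (KC p T).Monic := fun T => monic_prod_of_monic _ _ fun u _ => monic_X_add_C _
  have hprodm : (∏ j ∈ ((range 9).erase j₁).erase j₂, KF p n (β j)).Monic :=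
    monic_prod_of_monic _ _ fun j _ => hKFm _
  rw [M2, leadingCoeff_mul, leadingCoeff_mul, leadingCoeff_linear h2z, hmidm.leadingCoeff,
    ((hprodm.mul (hKFm _)).mul ((hKCm _).mul (hKCm _))).leadingCoeff, mul_one, mul_one]

/-- **The critical top power sum.**  If `(X^p − X)² ∣ M` and `deg M = p² + p − 1` (`p ≥ 3`), then
`Σ_{x ∈ 𝔽_p} [X^p] M(X + x) = lc(M)`: with `M = (X^p − X)²·N`, `[X^p] M(X+x) = [X^{p−2}] N(X+x)`
(`taylor_coeff_card_of_sq_mul`) and `N` has the top degree `(p−2) + (p−1)²` for the index `p − 2 < p`. -/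
theorem sum_taylor_coeff_card_top (hp3 : 3 ≤ p) (M : (ZMod p)[X]) (hM : (X ^ p - X) ^ 2 ∣ M)
    (hdeg : M.natDegree = 2 * p + ((p - 2) + (p - 2 + 1) * (p - 1))) :
    ∑ x : ZMod p, (taylor x M).coeff p = M.leadingCoeff := by
  obtain ⟨N, rfl⟩ := hM
  simp_rw [taylor_coeff_card_of_sq_mul]
  have hW0 : ((X : (ZMod p)[X]) ^ p - X) ^ 2 ≠ 0 := pow_ne_zero _ X_pow_card_sub_X_ne_zero'
  have hN0 : N ≠ 0 := by
    rintro rfl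
    rw [mul_zero, natDegree_zero] at hdeg
    omega
  have hdegW : (((X : (ZMod p)[X]) ^ p - X) ^ 2).natDegree = 2 * p := by
    rw [natDegree_pow, natDegree_X_pow_card_sub_X']
  have hdegN : N.natDegree = (p - 2) + (p - 2 + 1) * (p - 1) := by
    rw [natDegree_mul hW0 hN0, hdegW] at hdeg; omega
  have hlcW : (((X : (ZMod p)[X]) ^ p - X) ^ 2).leadingCoeff = 1 := by
    rw [leadingCoeff_pow, leadingCoeff_sub_of_degree_lt, leadingCoeff_X_pow, one_pow]
    rw [degree_X_pow, degree_X]; exact_mod_cast hp.out.one_lt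
  rw [sum_taylor_coeff_top N (p - 2) (by omega) hdegN, leadingCoeff_mul, hlcW, one_mul]
  have hodd : Odd (p - 2) := by
    rcases hp.out.eq_two_or_odd' with h | h
    · omega
    · obtain ⟨m, hm⟩ := h
      exact ⟨m - 1, by omega⟩
  rw [hodd.neg_one_pow]; ring

end ModP2

/-! ### 2. Sharpness in the slot regime: `v_p(K_u) = 0` at `u·p = d₉ + 3` -/

section Sharpness

/-- **(W)₉∞ IS SHARP IN THE SLOT REGIME.**  `b` in the polytope (`InBox`, `2b_j ≤ b₀`); slots `j₁` (dropped), `j₂ ≠ j₁`,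
`j₃` with `b_{j₂} ≤ b_{j₃} ≤ b_j` for `j ∉ {j₁, j₂}`; `p` prime, `p ≥ 7`, `b₀ + 1 ≤ p + b_{j₂} + b_{j₃}` and
`p = d₉(b) + 3` ⟹ `coeff3 b ≠ 0 ∧ v_p(coeff3 b) = 0`.  (`deg M2 = 8p − 1` is the top degree for the read index `7`;
at `p = 7` the index is critical and `sum_taylor_coeff_card_top` reads `N = M2/(X^p−X)²` instead.)
Up to the choice of slots it covers `BigPrimeNineSharp.padicValRat_coeff3_eq_zero_of_eq_dNine_add_three` (`p ≥ b₀ + 1`). -/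
theorem padicValRat_coeff3_eq_zero_of_slots (b : ℕ → ℤ) (p j₁ j₂ j₃ : ℕ) (hb : InBox b)
    (h2 : ∀ i ∈ range 9, 2 * b (i + 1) ≤ b 0) (hj₁ : j₁ ∈ range 9) (hj₂ : j₂ ∈ range 9) (hj₃ : j₃ ∈ range 9)
    (h12 : j₂ ≠ j₁) (hle : b (j₂ + 1) ≤ b (j₃ + 1))
    (hmin : ∀ j ∈ range 9, j ≠ j₁ → j ≠ j₂ → b (j₃ + 1) ≤ b (j + 1)) (hprime : p.Prime) (hp7 : 7 ≤ p)
    (hpT : b 0 + 1 ≤ (p : ℤ) + b (j₂ + 1) + b (j₃ + 1)) (hpd : (p : ℤ) = dNine b + 3) :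
    coeff3 b ≠ 0 ∧ padicValRat p (coeff3 b) = 0 := by
  haveI : Fact p.Prime := ⟨hprime⟩
  obtain ⟨e0, hS, hβ⟩ := polytope_data b hb h2
  obtain ⟨hj₂', h23, hmin', hT', hS', h3'⟩ := slot_data b hb h2 hj₂ hj₃ h12 hle hmin hpT
  have hpd' : p + ∑ j ∈ range 9, (b (j + 1)).toNat = 4 * (b 0).toNat + 3 := by
    have := hpd; rw [dNine, hS, e0] at this; omega
  have hsum : ∑ i ∈ range 9, b (i + 1) ≤ 4 * b 0 + 2 := by
    have := hpd; rw [dNine] at this; omega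
  have hhalf : ∀ j ∈ range 9, 2 * b (j + 1) ≤ b 0 + 1 := fun j hj => by have := h2 j hj; omega
  obtain ⟨c, hc⟩ := exists_isPFData9 b hb hsum
  have hUK := U2all_mul_sum_eq b hb hhalf hc hj₁ hj₂' h23 hmin' (o := 2) (by norm_num) (by norm_num)
  rw [← coeff3_eq hc] at hUK
  refine padicValRat_eq_zero_of_eq hUK (not_dvd_U2all hprime hT' h23) ?_
  have hdeg : (M2 p (b 0).toNat (fun j => (b (j + 1)).toNat) j₁ j₂ j₃).natDegree = 8 * p - 1 := by
    have := natDegree_M2_eq (p := p) (by omega) hj₁ hj₂' hS' hT' h23 hmin' hβ h3'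
    beta_reduce at this
    omega
  have hU : ((U2all (b 0).toNat (fun j => (b (j + 1)).toNat) j₂ j₃ : ℤ) : ZMod p) ≠ 0 := by
    rw [Ne, ZMod.intCast_zmod_eq_zero_iff_dvd]; exact not_dvd_U2all hprime hT' h23
  have htwo : (2 : ZMod p) ≠ 0 := two_ne_zero_zmod (by omega)
  rw [← ZMod.intCast_zmod_eq_zero_iff_dvd, Z2sum_cast hj₁ hj₂' hS' hT' h23 h3' hmin' (by norm_num : 5 < 6) (by omega)]
  rcases (show p = 7 ∨ 7 < p by omega) with rfl | hlt
  · rw [sum_taylor_coeff_card_top (by norm_num) _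
        (X_pow_card_sub_X_sq_dvd_M2 hj₁ hj₂' hT' h23 h3' hmin') (by omega), leadingCoeff_M2 (by norm_num)]
    exact mul_ne_zero hU htwo
  · rw [sum_taylor_coeff_top _ 7 hlt (by omega), leadingCoeff_M2 (by omega)]
    intro h
    refine mul_ne_zero hU htwo ?_
    linear_combination h

/-- **(U)₉∞ IS SHARP IN THE SLOT REGIME**: same slots, `p ≥ 5`, `b₀ + 1 ≤ p + b_{j₂} + b_{j₃}`, `2p = d₉(b) + 3` ⟹
`coeff5 b ≠ 0 ∧ v_p(coeff5 b) = 0` (`deg M2 = 6p − 1`; at `p = 5` the read index `5` is critical). -/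
theorem padicValRat_coeff5_eq_zero_of_slots (b : ℕ → ℤ) (p j₁ j₂ j₃ : ℕ) (hb : InBox b)
    (h2 : ∀ i ∈ range 9, 2 * b (i + 1) ≤ b 0) (hj₁ : j₁ ∈ range 9) (hj₂ : j₂ ∈ range 9) (hj₃ : j₃ ∈ range 9)
    (h12 : j₂ ≠ j₁) (hle : b (j₂ + 1) ≤ b (j₃ + 1))
    (hmin : ∀ j ∈ range 9, j ≠ j₁ → j ≠ j₂ → b (j₃ + 1) ≤ b (j + 1)) (hprime : p.Prime) (hp5 : 5 ≤ p)
    (hpT : b 0 + 1 ≤ (p : ℤ) + b (j₂ + 1) + b (j₃ + 1)) (hpd : 2 * (p : ℤ) = dNine b + 3) :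
    coeff5 b ≠ 0 ∧ padicValRat p (coeff5 b) = 0 := by
  haveI : Fact p.Prime := ⟨hprime⟩
  obtain ⟨e0, hS, hβ⟩ := polytope_data b hb h2
  obtain ⟨hj₂', h23, hmin', hT', hS', h3'⟩ := slot_data b hb h2 hj₂ hj₃ h12 hle hmin hpT
  have hpd' : 2 * p + ∑ j ∈ range 9, (b (j + 1)).toNat = 4 * (b 0).toNat + 3 := by
    have := hpd; rw [dNine, hS, e0] at this; omega
  have hsum : ∑ i ∈ range 9, b (i + 1) ≤ 4 * b 0 + 2 := by
    have := hpd; rw [dNine] at this; omega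
  have hhalf : ∀ j ∈ range 9, 2 * b (j + 1) ≤ b 0 + 1 := fun j hj => by have := h2 j hj; omega
  obtain ⟨c, hc⟩ := exists_isPFData9 b hb hsum
  have hUK := U2all_mul_sum_eq b hb hhalf hc hj₁ hj₂' h23 hmin' (o := 4) (by norm_num) (by norm_num)
  rw [← coeff5_eq hc] at hUK
  refine padicValRat_eq_zero_of_eq hUK (not_dvd_U2all hprime hT' h23) ?_
  have hdeg : (M2 p (b 0).toNat (fun j => (b (j + 1)).toNat) j₁ j₂ j₃).natDegree = 6 * p - 1 := by
    have := natDegree_M2_eq (p := p) (by omega) hj₁ hj₂' hS' hT' h23 hmin' hβ h3'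
    beta_reduce at this
    omega
  have hU : ((U2all (b 0).toNat (fun j => (b (j + 1)).toNat) j₂ j₃ : ℤ) : ZMod p) ≠ 0 := by
    rw [Ne, ZMod.intCast_zmod_eq_zero_iff_dvd]; exact not_dvd_U2all hprime hT' h23
  have htwo : (2 : ZMod p) ≠ 0 := two_ne_zero_zmod (by omega)
  rw [← ZMod.intCast_zmod_eq_zero_iff_dvd, Z2sum_cast hj₁ hj₂' hS' hT' h23 h3' hmin' (by norm_num : 3 < 6) (by omega)]
  rcases (show p = 5 ∨ 5 < p by omega) with rfl | hlt
  · rw [sum_taylor_coeff_card_top (by norm_num) _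
        (X_pow_card_sub_X_sq_dvd_M2 hj₁ hj₂' hT' h23 h3' hmin') (by omega), leadingCoeff_M2 (by norm_num)]
    exact mul_ne_zero hU htwo
  · rw [sum_taylor_coeff_top _ 5 hlt (by omega), leadingCoeff_M2 (by omega)]
    intro h
    refine mul_ne_zero hU htwo ?_
    linear_combination h

/-- **(S)₉∞ IS SHARP IN THE SLOT REGIME**: same slots, `p ≥ 5`, `b₀ + 1 ≤ p + b_{j₂} + b_{j₃}`, `3p = d₉(b) + 3` ⟹
`coeff7 b ≠ 0 ∧ v_p(coeff7 b) = 0` (`deg M2 = 4p − 1`, read index `3 < p`). -/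
theorem padicValRat_coeff7_eq_zero_of_slots (b : ℕ → ℤ) (p j₁ j₂ j₃ : ℕ) (hb : InBox b)
    (h2 : ∀ i ∈ range 9, 2 * b (i + 1) ≤ b 0) (hj₁ : j₁ ∈ range 9) (hj₂ : j₂ ∈ range 9) (hj₃ : j₃ ∈ range 9)
    (h12 : j₂ ≠ j₁) (hle : b (j₂ + 1) ≤ b (j₃ + 1))
    (hmin : ∀ j ∈ range 9, j ≠ j₁ → j ≠ j₂ → b (j₃ + 1) ≤ b (j + 1)) (hprime : p.Prime) (hp5 : 5 ≤ p)
    (hpT : b 0 + 1 ≤ (p : ℤ) + b (j₂ + 1) + b (j₃ + 1)) (hpd : 3 * (p : ℤ) = dNine b + 3) :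
    coeff7 b ≠ 0 ∧ padicValRat p (coeff7 b) = 0 := by
  haveI : Fact p.Prime := ⟨hprime⟩
  obtain ⟨e0, hS, hβ⟩ := polytope_data b hb h2
  obtain ⟨hj₂', h23, hmin', hT', hS', h3'⟩ := slot_data b hb h2 hj₂ hj₃ h12 hle hmin hpT
  have hpd' : 3 * p + ∑ j ∈ range 9, (b (j + 1)).toNat = 4 * (b 0).toNat + 3 := by
    have := hpd; rw [dNine, hS, e0] at this; omega
  have hsum : ∑ i ∈ range 9, b (i + 1) ≤ 4 * b 0 + 2 := by
    have := hpd; rw [dNine] at this; omega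
  have hhalf : ∀ j ∈ range 9, 2 * b (j + 1) ≤ b 0 + 1 := fun j hj => by have := h2 j hj; omega
  obtain ⟨c, hc⟩ := exists_isPFData9 b hb hsum
  have hUK := U2all_mul_sum_eq b hb hhalf hc hj₁ hj₂' h23 hmin' (o := 6) (by norm_num) (by norm_num)
  rw [← coeff7_eq hc] at hUK
  refine padicValRat_eq_zero_of_eq hUK (not_dvd_U2all hprime hT' h23) ?_
  have hdeg : (M2 p (b 0).toNat (fun j => (b (j + 1)).toNat) j₁ j₂ j₃).natDegree = 3 + (3 + 1) * (p - 1) := by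
    have := natDegree_M2_eq (p := p) (by omega) hj₁ hj₂' hS' hT' h23 hmin' hβ h3'
    beta_reduce at this
    omega
  have hU : ((U2all (b 0).toNat (fun j => (b (j + 1)).toNat) j₂ j₃ : ℤ) : ZMod p) ≠ 0 := by
    rw [Ne, ZMod.intCast_zmod_eq_zero_iff_dvd]; exact not_dvd_U2all hprime hT' h23
  have htwo : (2 : ZMod p) ≠ 0 := two_ne_zero_zmod (by omega)
  rw [← ZMod.intCast_zmod_eq_zero_iff_dvd, Z2sum_cast hj₁ hj₂' hS' hT' h23 h3' hmin' (by norm_num : 1 < 6) (by omega),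
    sum_taylor_coeff_top _ 3 (by omega) hdeg, leadingCoeff_M2 (by omega)]
  intro h
  refine mul_ne_zero hU htwo ?_
  linear_combination h

end Sharpness

/-- Instances of the three ends inside the slot regime below `b₀` (all within the scanned range, `v_p = 0` there):
`(7;3⁸,0)`: `d₉ = 4`, `p = 7 = d₉ + 3 ≤ b₀` — a residual top instance of (W)₉ (`L₂ = 2`); `(5;2⁵,1³,0)`: `d₉ = 7`,
`2·5 = d₉ + 3` — a residual top instance of (U)₉ (`L₂ = 4`); `(6;2⁴,1⁴,0)`: `d₉ = 12`, `3·5 = d₉ + 3` (`L₂ = 5`). -/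
example : (4 : ℤ) * 7 - 24 + 3 = 7 ∧ (4 : ℤ) * 5 - 13 + 3 = 2 * 5 ∧ (4 : ℤ) * 6 - 12 + 3 = 3 * 5 := by norm_num

end Summit.KontsevichZagierPeriods.Zeta5Search.BigPrimeNine

end
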